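import Summits.QuantumFields.BalabanUV.Beta.GAN24.StencilSlotLam

/-!
# `BalabanUV.Beta.GAN24.StencilSlotLamDrift` — binder row G-an2-4 / (CONV-C), AFTER the K-slot: the DRIFT (`hSall`-shape) of the
# LAGRANGE SUMMAND (P-Λ) of the wall's stencil slot, between any two members `k+j+1`, `k+1`, IS A FUNCTION OF THE K-SLOT's Cauchy half
# `CauchyDecayK` (note `HOME/b2b-balaban-gan24-p1/S-SLOT.md` §2 (P-Λ), §5 target S2 — the «next append» announced in `GAN24/StencilSlotLam`)

NOT IN PRINT; OUR PROOF ATTEMPT (row owner b2b-balaban-gan24-p1, gen 3).  HONEST FRAMING (cell contract, verbatim): «discharging `BetaPertH`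
makes Bałaban's UV stability UNCONDITIONAL — a real constructive-QFT result; it is NOT the continuum limit and NOT the Clay problem.»
HONEST DEPENDENCY (verbatim): «continuum YM on T⁴ ⇐ BetaPertH ∧ nine spine estimates (0/9 proved); BetaPertH ⇐ (D1) ∧ (D4) ∧ CAP+tail;
G-an2-4 gates asym, D1 and NE2/3/4.»  [folklore] real analysis over the tree's definitions: linearity of an2's coarse superposition
`InterLevelTransport.cwsum` / `SLam` under the summability that decaying weights provide, the telescoping
`A₁∘E₁ − A₂∘E₂ = (A₁−A₂)∘E₁ + A₂∘(E₁−E₂)` at the `lamCoeffK` entry (an2's `KernelWard.comp_sub_left/right` BY NAME), and the composition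
brick `BalabanStepJetsSucc.abs_lamCoeffK_le` BY NAME; no new estimate, no cited fact, no `def`, no `Prop` mirror.  The K-slot data enter as
HYPOTHESES `UnitDecayK … C δ` and `CauchyDecayK … cK θ δ` (`GAN24.CombesThomas`; = the wall's `hK`, `hKall` in the adopted units; for `d = 3`
they are road P1's outputs `ConvCKWall 3 Lc`) — asserted nowhere here.  NOTHING of the wall is discharged: one of three summands, members
`≥ 1` only (member `0` = `BalabanStepJets.S0` and the `e3Of` summand untouched); 0 wall binders instantiated.  NOT summit progress.

## What is proved (generic `d`; `Lc` with `NeZero Lc`)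
* §1 `onLat_weight_bound`, `onLat_biLoc` (the two case analyses of `InterLevelTransport.biLoc_cwsum`, isolated), `summable_cwsumTerm`,
  **`cwsum_sub`** and **`SLam_sub`**: `S^Λ(c₁) − S^Λ(c₂) = S^Λ(c₁ − c₂)` entrywise, for coefficients decaying from the fine bond and a
  vertex family `Q` (summability supplied, no hypothesis on the reader).
* §2 `summable_compTerm_dd` (decaying ∘ decaying slices are summable), **`lamCoeffK_sub`**:
  `lamCoeffK A₁ E₁ − lamCoeffK A₂ E₂ = lamCoeffK (A₁ − A₂) E₁ + lamCoeffK A₂ (E₁ − E₂)` for decaying factors; `decays_E2unit_sub`: the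
  rescaled `E″` of two members differ by the K-slot's Cauchy datum (`E″`-dictionary of `StencilSlotLam` + dilation);
  **`abs_lamCoeff_sub_le`**: the coefficient drift `≤ (|Fib d|·C·cK·Zl(δ/2)·(θ+1))·θ^k·e^{−(δ/2)|Lc•y − u|₁}`.
* §3 **`locStencil_unitS_lamPiece_sub`**: from `UnitDecayK … C δ`, `CauchyDecayK … cK θ δ`, `0 < δ`, `0 ≤ θ`, `1 ≤ Lc`: for all `k j`,
  `LocStencil (normalised Λ-summand of member k+j+1 − normalised Λ-summand of member k+1) (CΛdrift · θ^k) (δ/4)` with ONE explicit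
  `k,j`-free `CΛdrift = |cΛ·Lc^{2(d+1)}|·(d+1)·(|Fib d|·C·cK·Zl(δ/2)·(θ+1))·(2ℓ²e^{2(d+1)Lcδ})·Zl(δ/4)` — the `hSall`-shape for this summand
  over the members `≥ 1`, in the K-slot's currency.
-/

noncomputable section

open Literature.MathematicalPhysics.QuantumFieldTheory
open Literature.MathematicalPhysics.QuantumFieldTheory.Balaban1983to89
open Literature.MathematicalPhysics.QuantumFieldTheory.Balaban1983to89.Beta
open Literature.Probability.LatticeModels (Torus.proj)
open LatticeForm (quo)
open B12Sec2to5 (l1 l1_nonneg)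
open ExpKernelCalculus (MKer Decays BiLoc VertexFamily comp Zl Zl_nonneg summable_exp_shift l1_sub_triangle exp_split)
open OneStepResolventKernel (Fib LocStencil wsum summable_wsumTerm eq_zsmul_quo_of_proj)
open OneStepKernelFamily (KInvStep)
open InterLevelTransport (SLam cwsum onLat onLat_off locStencil_SLam)
open AveragingHessianKernels (hessFF ell biLoc_hessFF)
open BalabanStepJetsSucc (wΛ E2 lamCoeffK abs_lamCoeffK_le abs_compTerm_le_dd l1_sub_le_l1_smul_sub)
open KernelWard (comp_sub_left comp_sub_right)
open HessKerRate (decays_sub)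
open Summit.QuantumFields.BalabanUV.Beta.HessKerDressedUnits (unitK unitS)
open Summit.QuantumFields.BalabanUV.Beta.GAN24.CombesThomas (sfStep smStep KStepUnit UnitDecayK CauchyDecayK)
open Summit.QuantumFields.BalabanUV.Beta.GAN24.StencilSlotLam (unitS_lamPiece_eq decays_E2unit smul_E2_succ_inl_inl E2_inl_inr E2_inr)

namespace Summit.QuantumFields.BalabanUV.Beta.GAN24.StencilSlotLamDrift

variable {d : ℕ}

/-! ## §1 Linearity of the coarse superposition and of `S^Λ` under decay-supplied summability -/

section Superposition

variable {N : ℕ} [NeZero N]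

/-- [folklore] Coarse weights decaying (fine units) from `p`, extended by zero, decay from `p` as fine weights. -/
theorem onLat_weight_bound {w : (Fin (d + 1) → ℤ) → ℝ} {C δ : ℝ} {p : Fin (d + 1) → ℤ}
    (hw : ∀ y, |w y| ≤ C * Real.exp (-δ * l1 ((N : ℤ) • y - p))) (hC : 0 ≤ C) (v : Fin (d + 1) → ℤ) :
    |onLat N w v| ≤ C * Real.exp (-δ * l1 (v - p)) := by
  by_cases hv : Torus.proj N v = 0
  · have e := eq_zsmul_quo_of_proj (N := N) hv
    simp only [onLat, hv, if_true]
    have h := hw (quo N v)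
    rwa [← e] at h
  · rw [onLat_off w hv, abs_zero]
    positivity

/-- [folklore] A coarse-indexed family bi-localised at its own coarse point, extended by zero, is bi-localised at its own fine index. -/
theorem onLat_biLoc {Q : (Fin (d + 1) → ℤ) → MKer (d + 1) (Fib d)} {Cq δ : ℝ}
    (hQ : ∀ y, BiLoc (Q y) ((N : ℤ) • y) ((N : ℤ) • y) Cq δ) (v : Fin (d + 1) → ℤ) : BiLoc (onLat N Q v) v v Cq δ := by
  have hCq : 0 ≤ Cq := (hQ 0).nonneg (Sum.inl 0)
  by_cases hv : Torus.proj N v = 0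
  · have e := eq_zsmul_quo_of_proj (N := N) hv
    simp only [onLat, hv, if_true]
    have h := hQ (quo N v)
    rwa [← e] at h
  · intro x z a b
    rw [onLat_off Q hv]
    show |(0 : ℝ)| ≤ _
    rw [abs_zero]
    positivity

/-- [folklore] Summability of the coarse superposition series (entry by entry). -/
theorem summable_cwsumTerm {w : (Fin (d + 1) → ℤ) → ℝ} {Q : (Fin (d + 1) → ℤ) → MKer (d + 1) (Fib d)} {C Cq δ : ℝ}
    {p : Fin (d + 1) → ℤ} (hw : ∀ y, |w y| ≤ C * Real.exp (-δ * l1 ((N : ℤ) • y - p)))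
    (hQ : ∀ y, BiLoc (Q y) ((N : ℤ) • y) ((N : ℤ) • y) Cq δ) (hδ : 0 < δ) (hC : 0 ≤ C) (x z : Fin (d + 1) → ℤ) (a b : Fib d) :
    Summable fun v : Fin (d + 1) → ℤ => onLat N w v * onLat N Q v x z a b :=
  summable_wsumTerm (onLat_weight_bound hw hC) (onLat_biLoc hQ) hδ hC x z a b

/-- [folklore] **LINEARITY OF THE COARSE SUPERPOSITION IN THE WEIGHTS** (entrywise), for two decaying weight families over one
bi-localised kernel family. -/
theorem cwsum_sub {w₁ w₂ : (Fin (d + 1) → ℤ) → ℝ} {Q : (Fin (d + 1) → ℤ) → MKer (d + 1) (Fib d)} {C₁ C₂ Cq δ : ℝ}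
    {p : Fin (d + 1) → ℤ} (hw₁ : ∀ y, |w₁ y| ≤ C₁ * Real.exp (-δ * l1 ((N : ℤ) • y - p)))
    (hw₂ : ∀ y, |w₂ y| ≤ C₂ * Real.exp (-δ * l1 ((N : ℤ) • y - p)))
    (hQ : ∀ y, BiLoc (Q y) ((N : ℤ) • y) ((N : ℤ) • y) Cq δ) (hδ : 0 < δ) (hC₁ : 0 ≤ C₁) (hC₂ : 0 ≤ C₂)
    (x z : Fin (d + 1) → ℤ) (a b : Fib d) :
    cwsum N w₁ Q x z a b - cwsum N w₂ Q x z a b = cwsum N (fun y => w₁ y - w₂ y) Q x z a b := by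
  unfold cwsum wsum
  rw [← (summable_cwsumTerm hw₁ hQ hδ hC₁ x z a b).tsum_sub (summable_cwsumTerm hw₂ hQ hδ hC₂ x z a b)]
  refine tsum_congr fun v => ?_
  by_cases hv : Torus.proj N v = 0
  · simp only [onLat, hv, if_true]; ring
  · simp only [onLat, hv, if_false]; ring

/-- [folklore] **LINEARITY OF `S^Λ` IN ITS COEFFICIENTS** (entrywise): for coefficient families decaying from the fine bond (rate `δ`)
and a vertex family `Q`, `S^Λ(c₁) − S^Λ(c₂) = S^Λ(c₁ − c₂)`. -/
theorem SLam_sub {c₁ c₂ : Fin (d + 1) → (Fin (d + 1) → ℤ) → Fin (d + 1) → (Fin (d + 1) → ℤ) → ℝ}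
    {Q : Fin (d + 1) → (Fin (d + 1) → ℤ) → MKer (d + 1) (Fib d)} {C₁ C₂ Cq δ : ℝ}
    (hc₁ : ∀ μ y κ u, |c₁ μ y κ u| ≤ C₁ * Real.exp (-δ * l1 ((N : ℤ) • y - u)))
    (hc₂ : ∀ μ y κ u, |c₂ μ y κ u| ≤ C₂ * Real.exp (-δ * l1 ((N : ℤ) • y - u)))
    (hQ : VertexFamily Q N Cq δ) (hδ : 0 < δ) (hC₁ : 0 ≤ C₁) (hC₂ : 0 ≤ C₂)
    (κ : Fin (d + 1)) (u x z : Fin (d + 1) → ℤ) (a b : Fib d) :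
    SLam N c₁ Q κ u x z a b - SLam N c₂ Q κ u x z a b = SLam N (fun μ y κ u => c₁ μ y κ u - c₂ μ y κ u) Q κ u x z a b := by
  simp only [SLam]
  rw [← neg_sub, sub_eq_add_neg, neg_neg, add_comm, ← sub_eq_add_neg, ← Finset.sum_sub_distrib]
  congr 1
  refine Finset.sum_congr rfl fun μ _ => ?_
  exact cwsum_sub (fun y => hc₁ μ y κ u) (fun y => hc₂ μ y κ u) (fun y => hQ μ y) hδ hC₁ hC₂ x z a b

end Superposition

/-! ## §2 The coefficient drift: telescoping at the `lamCoeffK` entry, fed by the K-slot's Cauchy datum -/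

section Coefficients

/-- [folklore] Decaying ∘ decaying slices are summable. -/
theorem summable_compTerm_dd {A B : MKer (d + 1) (Fib d)} {CA CB δ : ℝ} (hA : Decays A CA δ) (hB : Decays B CB δ) (hδ : 0 < δ)
    (x z : Fin (d + 1) → ℤ) (a b : Fib d) : Summable fun y : Fin (d + 1) → ℤ => ∑ f, A x y a f * B y z f b := by
  refine Summable.of_norm_bounded ((summable_exp_shift (show 0 < δ - 0 by linarith) x).mul_left
    ((Fintype.card (Fib d) : ℝ) * (CA * CB) * Real.exp (-0 * l1 (x - z)))) (fun y => ?_)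
  rw [Real.norm_eq_abs]
  exact abs_compTerm_le_dd hA hB le_rfl hδ.le x z a b y

/-- [folklore] **TELESCOPING AT THE MULTIPLIER-RESPONSE ENTRY**: for decaying `A₁ A₂ E₁ E₂` (common rate `δ > 0`),
`lamCoeffK A₁ E₁ − lamCoeffK A₂ E₂ = lamCoeffK (A₁ − A₂) E₁ + lamCoeffK A₂ (E₁ − E₂)`. -/
theorem lamCoeffK_sub {A₁ A₂ E₁ E₂ : MKer (d + 1) (Fib d)} {C₁ C₂ D₁ D₂ δ : ℝ} (hA₁ : Decays A₁ C₁ δ) (hA₂ : Decays A₂ C₂ δ)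
    (hE₁ : Decays E₁ D₁ δ) (hE₂ : Decays E₂ D₂ δ) (hδ : 0 < δ) (N : ℕ) (μ : Fin (d + 1)) (y : Fin (d + 1) → ℤ) (κ : Fin (d + 1))
    (u : Fin (d + 1) → ℤ) :
    lamCoeffK A₁ E₁ N μ y κ u - lamCoeffK A₂ E₂ N μ y κ u =
      lamCoeffK (A₁ - A₂) E₁ N μ y κ u + lamCoeffK A₂ (E₁ - E₂) N μ y κ u := by
  unfold lamCoeffK
  rw [comp_sub_left (fun x z a b => summable_compTerm_dd hA₁ hE₁ hδ x z a b) (fun x z a b => summable_compTerm_dd hA₂ hE₁ hδ x z a b),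
    comp_sub_right (fun x z a b => summable_compTerm_dd hA₂ hE₁ hδ x z a b) (fun x z a b => summable_compTerm_dd hA₂ hE₂ hδ x z a b)]
  simp only [Pi.sub_apply]
  ring

variable {Lc : ℕ} [NeZero Lc]

/-- [folklore] **THE RESCALED `E″` OF TWO MEMBERS DIFFER BY THE K-SLOT's CAUCHY DATUM**: if `Decays (KStepUnit (k+j) − KStepUnit k) ε δ`
(`0 ≤ δ`) then `Decays ((s_m (k+j))² • E2 (k+j+1) − (s_m k)² • E2 (k+1)) ε δ`. -/
theorem decays_E2unit_sub {ε δ : ℝ} {k j : ℕ}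
    (h : Decays (KStepUnit (d := d) Lc (k + j) - KStepUnit (d := d) Lc k) ε δ) (hδ : 0 ≤ δ) :
    Decays ((smStep d Lc (k + j)) ^ 2 • E2 d Lc (k + j + 1) - (smStep d Lc k) ^ 2 • E2 d Lc (k + 1)) ε δ := by
  have hε : 0 ≤ ε := h.nonneg (Sum.inl 0)
  have hLc : 1 ≤ Lc := Nat.one_le_iff_ne_zero.2 (NeZero.ne Lc)
  intro z u a b
  have hpos : 0 ≤ ε * Real.exp (-δ * l1 (z - u)) := by positivity
  rcases a with α | ν
  · rcases b with κ | ν'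
    · rw [Pi.sub_apply, Pi.sub_apply, Pi.sub_apply, Pi.sub_apply, smul_E2_succ_inl_inl, smul_E2_succ_inl_inl]
      have h1 := h ((Lc : ℤ) • z) ((Lc : ℤ) • u) (Sum.inr α) (Sum.inr κ)
      rw [Pi.sub_apply, Pi.sub_apply, Pi.sub_apply, Pi.sub_apply] at h1
      refine h1.trans (mul_le_mul_of_nonneg_left ?_ hε)
      rw [Real.exp_le_exp]
      have h2 := l1_sub_le_l1_smul_sub (d := d) hLc z u
      nlinarith
    · simp only [Pi.sub_apply, Pi.smul_apply, smul_eq_mul, E2_inl_inr, mul_zero, sub_zero, abs_zero]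
      exact hpos
  · simp only [Pi.sub_apply, Pi.smul_apply, smul_eq_mul, E2_inr, mul_zero, sub_zero, abs_zero]
    exact hpos

/-- [folklore] **THE COEFFICIENT DRIFT FROM THE K-SLOT**: with `A_n := KStepUnit Lc n`, `E′_n := (s_m n)² • E2 (n+1)`,
`c_n := lamCoeffK A_{n+1} E′_n Lc`, uniform decay `C, δ` of all `A_n` and the Cauchy datum `Decays (A_{k+j} − A_k) (cK θ^k) δ` for all
`k, j` give `|c_{k+j} − c_k| ≤ (|Fib d|·(cK θ^{k+1}·C + C·cK θ^k)·Zl(δ − δ/2))·e^{−(δ/2)|Lc•y − u|₁}`. -/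
theorem abs_lamCoeff_sub_le {C cK θ δ : ℝ} (hK : UnitDecayK d Lc (sfStep Lc) (smStep d Lc) C δ)
    (hKall : CauchyDecayK d Lc (sfStep Lc) (smStep d Lc) cK θ δ) (hδ : 0 < δ) (k j : ℕ) (μ : Fin (d + 1))
    (y : Fin (d + 1) → ℤ) (κ : Fin (d + 1)) (u : Fin (d + 1) → ℤ) :
    |lamCoeffK (KStepUnit (d := d) Lc (k + j + 1)) ((smStep d Lc (k + j)) ^ 2 • E2 d Lc (k + j + 1)) Lc μ y κ u -
        lamCoeffK (KStepUnit (d := d) Lc (k + 1)) ((smStep d Lc k) ^ 2 • E2 d Lc (k + 1)) Lc μ y κ u| ≤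
      ((Fintype.card (Fib d) : ℝ) * (cK * θ ^ (k + 1) * C) * Zl (d + 1) (δ - δ / 2) +
          (Fintype.card (Fib d) : ℝ) * (C * (cK * θ ^ k)) * Zl (d + 1) (δ - δ / 2)) *
        Real.exp (-(δ / 2) * l1 ((Lc : ℤ) • y - u)) := by
  have hA₁ : Decays (KStepUnit (d := d) Lc (k + j + 1)) C δ := hK (k + j + 1)
  have hA₂ : Decays (KStepUnit (d := d) Lc (k + 1)) C δ := hK (k + 1)
  have hE₁ : Decays ((smStep d Lc (k + j)) ^ 2 • E2 d Lc (k + j + 1)) C δ := decays_E2unit (hK (k + j)) hδ.le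
  have hE₂ : Decays ((smStep d Lc k) ^ 2 • E2 d Lc (k + 1)) C δ := decays_E2unit (hK k) hδ.le
  have hA₁₂ : Decays (KStepUnit (d := d) Lc (k + j + 1) - KStepUnit (d := d) Lc (k + 1)) (cK * θ ^ (k + 1)) δ := by
    have h := hKall (k + 1) j
    rw [show k + 1 + j = k + j + 1 by omega] at h
    exact h
  have hE₁₂ : Decays ((smStep d Lc (k + j)) ^ 2 • E2 d Lc (k + j + 1) - (smStep d Lc k) ^ 2 • E2 d Lc (k + 1)) (cK * θ ^ k) δ :=
    decays_E2unit_sub (hKall k j) hδ.le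
  rw [lamCoeffK_sub hA₁ hA₂ hE₁ hE₂ hδ]
  refine (abs_add_le _ _).trans ?_
  rw [add_mul]
  exact add_le_add (abs_lamCoeffK_le hA₁₂ hE₁ hδ Lc μ y κ u) (abs_lamCoeffK_le hA₂ hE₁₂ hδ Lc μ y κ u)

end Coefficients

/-! ## §3 The drift of the normalised Lagrange summand (`hSall`-shape for this summand, members `≥ 1`) -/

section Drift

variable {Lc : ℕ} [NeZero Lc]

/-- [folklore] **`hSall`-SHAPE FOR THE LAGRANGE SUMMAND, FROM THE K-SLOT**: uniform decay `UnitDecayK … C δ` and the Cauchy datum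
`CauchyDecayK … cK θ δ` of the unit-normalised step resolvents (`0 < δ`, `0 ≤ θ`, `1 ≤ Lc`) bound the difference of the normalised (P-Λ)
summands of members `k+j+1` and `k+1` in the local-stencil class, rate `δ/4`, with constant `CΛdrift · θ^k`,
`CΛdrift = |cΛ·Lc^{2(d+1)}|·((d+1)·((|Fib d|·(cK·θ·C + C·cK)·Zl(δ−δ/2))·(2ℓ²e^{4(d+1)Lc(δ/2)})·Zl(δ/4)))` (`k,j`-free). -/
theorem locStencil_unitS_lamPiece_sub (hLc : 1 ≤ Lc) {C cK θ δ : ℝ} (hK : UnitDecayK d Lc (sfStep Lc) (smStep d Lc) C δ)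
    (hKall : CauchyDecayK d Lc (sfStep Lc) (smStep d Lc) cK θ δ) (hδ : 0 < δ) (hθ : 0 ≤ θ) (cΛ : ℝ) (k j : ℕ) :
    LocStencil
      (fun κ u => unitS (sfStep Lc (k + j + 1)) (smStep d Lc (k + j + 1))
          (fun κ u => (cΛ * wΛ d Lc (k + j + 1)) •
            SLam Lc (lamCoeffK (KInvStep (d := d) Lc (k + j + 1)) (E2 d Lc (k + j + 1)) Lc) (fun μ y => hessFF Lc μ y) κ u) κ u -
        unitS (sfStep Lc (k + 1)) (smStep d Lc (k + 1))
          (fun κ u => (cΛ * wΛ d Lc (k + 1)) •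
            SLam Lc (lamCoeffK (KInvStep (d := d) Lc (k + 1)) (E2 d Lc (k + 1)) Lc) (fun μ y => hessFF Lc μ y) κ u) κ u)
      ((|cΛ * (Lc : ℝ) ^ (2 * (d + 1))| *
          ((d + 1 : ℕ) * (((Fintype.card (Fib d) : ℝ) * (cK * θ * C + C * cK) * Zl (d + 1) (δ - δ / 2)) *
            (2 * (ell (d + 1) Lc : ℝ) ^ 2 * Real.exp (4 * ((d : ℝ) + 1) * Lc * (δ / 2))) * Zl (d + 1) (δ / 2 / 2)))) * θ ^ k)
      (δ / 2 / 2) := by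
  rw [unitS_lamPiece_eq, unitS_lamPiece_eq]
  -- data
  have hC : 0 ≤ C := (hK 0).nonneg (Sum.inl 0)
  have hcK : 0 ≤ cK := by
    have h := (hKall 0 0).nonneg (Sum.inl 0)
    simpa using h
  have hδ2 : (0 : ℝ) ≤ δ / 2 := by positivity
  have hQ : VertexFamily (fun μ y => hessFF (d := d) Lc μ y) Lc
      (2 * (ell (d + 1) Lc : ℝ) ^ 2 * Real.exp (4 * ((d : ℝ) + 1) * Lc * (δ / 2))) (δ / 2) :=
    fun μ y => biLoc_hessFF hLc μ y hδ2
  -- the two coefficient families and their difference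
  set c₁ := lamCoeffK (KStepUnit (d := d) Lc (k + j + 1)) ((smStep d Lc (k + j)) ^ 2 • E2 d Lc (k + j + 1)) Lc with hc₁def
  set c₂ := lamCoeffK (KStepUnit (d := d) Lc (k + 1)) ((smStep d Lc k) ^ 2 • E2 d Lc (k + 1)) Lc with hc₂def
  have hZ : 0 ≤ Zl (d + 1) (δ - δ / 2) := Zl_nonneg (by linarith)
  have hcard : (0 : ℝ) ≤ Fintype.card (Fib d) := Nat.cast_nonneg _
  have hc₁ : ∀ μ y κ u, |c₁ μ y κ u| ≤ ((Fintype.card (Fib d) : ℝ) * (C * C) * Zl (d + 1) (δ - δ / 2)) *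
      Real.exp (-(δ / 2) * l1 ((Lc : ℤ) • y - u)) :=
    abs_lamCoeffK_le (hK (k + j + 1)) (decays_E2unit (hK (k + j)) hδ.le) hδ Lc
  have hc₂ : ∀ μ y κ u, |c₂ μ y κ u| ≤ ((Fintype.card (Fib d) : ℝ) * (C * C) * Zl (d + 1) (δ - δ / 2)) *
      Real.exp (-(δ / 2) * l1 ((Lc : ℤ) • y - u)) :=
    abs_lamCoeffK_le (hK (k + 1)) (decays_E2unit (hK k) hδ.le) hδ Lc
  have hCC : 0 ≤ (Fintype.card (Fib d) : ℝ) * (C * C) * Zl (d + 1) (δ - δ / 2) := by positivity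
  -- the drift bound on the coefficients, with θ^(k+1) + θ^k ≤ (θ + 1) θ^k folded in
  set Cd : ℝ := ((Fintype.card (Fib d) : ℝ) * (cK * θ * C + C * cK) * Zl (d + 1) (δ - δ / 2)) * θ ^ k with hCd
  have hCd0 : 0 ≤ Cd := by positivity
  have hdiff : ∀ μ y κ u, |c₁ μ y κ u - c₂ μ y κ u| ≤ Cd * Real.exp (-(δ / 2) * l1 ((Lc : ℤ) • y - u)) := by
    intro μ y κ u
    refine (abs_lamCoeff_sub_le hK hKall hδ k j μ y κ u).trans (le_of_eq ?_)
    rw [hCd]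
    ring
  -- S^Λ of the difference coefficients is a local stencil family
  have hS := locStencil_SLam (N := Lc) (c := fun μ y κ u => c₁ μ y κ u - c₂ μ y κ u) hdiff hQ (by positivity) hCd0
  -- conclude entrywise
  intro κ u x z a b
  have hlin := SLam_sub (N := Lc) hc₁ hc₂ hQ (by positivity) hCC hCC κ u x z a b
  have hb := hS κ u x z a b
  simp only [Pi.sub_apply, Pi.smul_apply, smul_eq_mul]
  rw [← mul_sub, hlin, abs_mul]
  refine (mul_le_mul_of_nonneg_left hb (abs_nonneg _)).trans (le_of_eq ?_)
  rw [hCd]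
  ring

end Drift

end Summit.QuantumFields.BalabanUV.Beta.GAN24.StencilSlotLamDrift

end
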